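import Mathlib.Analysis.SpecialFunctions.Log.Basic
import Literature.MathematicalPhysics.QuantumLattice.TransferOperatorDual
import HarnessLib

/-!
# Minorisation and Doeblin contraction for the transfer operator of an injective MPS tensor

Third helper file (after `TransferOperatorPerron.lean`, `TransferOperatorDual.lean`) towards the
discharge of `Literature.MathematicalPhysics.QuantumLattice.fannes_nachtergaele_werner_decay`
(`LiebRobinson.lean`); the contraction theorem itself is assembled in
`TransferOperatorContraction.lean`. Theorems only; no definition, no named fact.

* `IsInjectiveMPS.exists_minorisation` — **uniform minorisation** (quantum Doeblin condition):
  for an injective tensor and `X₀ > 0` there is `δ > 0` with `𝔼^ℓ(Z) ≥ δ (Re Tr Z) X₀` for all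
  `Z ≥ 0` (strict positivity of `𝔼^ℓ`, `TransferOperatorPerron`, plus compactness of
  `{Gᴴ G : ‖G‖ = 1} × {‖v‖ = 1}`).
* `enclosure_pow_of_posSemidef` — Loewner enclosures `a X₀ ≤ H ≤ b X₀` persist under a positive
  map fixing `X₀`.
* `doeblin_step`, `doeblin_iterate` — **oscillation contraction** (Markov–Dobrushin, in the
  Loewner order relative to `X₀`): under the minorisation and `Φ X₀ = X₀` an enclosure of width
  `b - a` improves to one of width `(1 - δ Re Tr X₀)(b - a)`; after `k` steps the width is
  `(1 - δ Re Tr X₀)^k (b - a)`.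
* `pow_div_le_two_mul_exp` — `θ^(n / ℓ) ≤ 2 e^{-n/ξ}` with `ξ = -ℓ / log (max θ ½)`.

## Sources

* M. Fannes, B. Nachtergaele, R. F. Werner, *Finitely correlated states on quantum spin chains*,
  Comm. Math. Phys. **144** (1992) 443–490, §5 (5.1) and Lemma 5.2 (strict contraction of the
  normalised transfer operator). [FannesNachtergaeleWernerCMP1992]
* R. L. Dobrushin, Theory Probab. Appl. **1** (1956) 65–80 (ergodic coefficient / oscillation
  contraction for Markov operators, classical form of `doeblin_step`).
* D. Perez-Garcia, F. Verstraete, M. M. Wolf, J. I. Cirac, Quantum Inf. Comput. **7** (2007) 401,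
  §3.2 (injective ⇒ primitive). [PerezGarciaVerstraeteWolfCiracQIC2007]
-/

noncomputable section

open Matrix Filter Topology
open scoped ComplexOrder MatrixOrder Matrix.Norms.L2Operator

namespace Literature.MathematicalPhysics.QuantumLattice

section QLattice

variable {q D : ℕ}

/-! ### Minorisation (Doeblin condition) for the iterated transfer operator -/

/-- **Uniform minorisation.** For an injective tensor (block length `ℓ`, `D > 0`) and a positive
definite `X₀` there is `δ > 0` with `𝔼^ℓ(Z) ≥ δ (Re Tr Z) X₀` for every `Z ≥ 0`: by strict
positivity (`IsInjectiveMPS.posDef_transferOp_pow`) the ratio `Re ⟨v, 𝔼^ℓ(Z) v⟩ / Re ⟨v, X₀ v⟩` is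
a continuous positive function on the compact set `{Gᴴ G : ‖G‖ = 1} × {‖v‖ = 1}`, hence bounded
below by some `δ₁ > 0`; homogeneity extends the bound to all `Z ≥ 0` with `Re Tr Z` in place of
the normalisation. This is the quantum Doeblin condition behind the strict contraction property
(5.1) of Fannes–Nachtergaele–Werner (1992) §5. [cite: FannesNachtergaeleWernerCMP1992, §5 (5.1)] -/
theorem IsInjectiveMPS.exists_minorisation [NeZero D] {A : MPSTensor q D} {ℓ : ℕ}
    (h : IsInjectiveMPS A ℓ) {X₀ : Matrix (Fin D) (Fin D) ℂ} (hX₀ : X₀.PosDef) :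
    ∃ δ : ℝ, 0 < δ ∧ ∀ Z : Matrix (Fin D) (Fin D) ℂ, Z.PosSemidef →
      ((transferOp A ^ ℓ) Z - ((δ * Z.trace.re : ℝ) : ℂ) • X₀).PosSemidef := by
  set T := transferOp A ^ ℓ with hT
  set S : Set (Matrix (Fin D) (Fin D) ℂ) :=
    (fun G : Matrix (Fin D) (Fin D) ℂ => Gᴴ * G) '' Metric.sphere 0 1 with hS
  set K : Set (Fin D → ℂ) := Metric.sphere 0 1 with hK
  have hScpt : IsCompact S := isCompact_normPSD D
  have hKcpt : IsCompact K := isCompact_sphere 0 1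
  obtain ⟨c₁, -, Z₁, hZ₁S, -⟩ := exists_smul_mem_normPSD (D := D) PosSemidef.one one_ne_zero
  have hSne : S.Nonempty := ⟨Z₁, hZ₁S⟩
  have hKne : K.Nonempty := NormedSpace.sphere_nonempty.mpr zero_le_one
  -- the ratio of quadratic forms, continuous and positive on `S × K`
  set F : Matrix (Fin D) (Fin D) ℂ × (Fin D → ℂ) → ℝ := fun p =>
    (star p.2 ⬝ᵥ (T p.1) *ᵥ p.2).re / (star p.2 ⬝ᵥ X₀ *ᵥ p.2).re with hF
  have hden : ∀ v : Fin D → ℂ, v ≠ 0 → 0 < (star v ⬝ᵥ X₀ *ᵥ v).re := fun v hv =>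
    hX₀.re_dotProduct_pos hv
  have hvK : ∀ v ∈ K, v ≠ 0 := by
    rintro v hv rfl
    simp [K] at hv
  have hFcont : ContinuousOn F (S ×ˢ K) := by
    have hnum : Continuous fun p : Matrix (Fin D) (Fin D) ℂ × (Fin D → ℂ) =>
        (star p.2 ⬝ᵥ (T p.1) *ᵥ p.2).re :=
      Complex.continuous_re.comp ((continuous_snd.star).dotProduct
        ((T.continuous_of_finiteDimensional.comp continuous_fst).matrix_mulVec continuous_snd))
    have hden' : Continuous fun p : Matrix (Fin D) (Fin D) ℂ × (Fin D → ℂ) =>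
        (star p.2 ⬝ᵥ X₀ *ᵥ p.2).re :=
      Complex.continuous_re.comp ((continuous_snd.star).dotProduct
        (continuous_const.matrix_mulVec continuous_snd))
    refine hnum.continuousOn.div hden'.continuousOn fun p hp => ?_
    exact (hden p.2 (hvK p.2 (Set.mem_prod.mp hp).2)).ne'
  obtain ⟨p₁, hp₁, hmin⟩ := (hScpt.prod hKcpt).exists_isMinOn (hSne.prod hKne) hFcont
  obtain ⟨hp₁S, hp₁K⟩ := Set.mem_prod.mp hp₁
  set δ₁ := F p₁ with hδ₁
  have hδ₁pos : 0 < δ₁ := by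
    have hpd : (T p₁.1).PosDef :=
      h.posDef_transferOp_pow (posSemidef_of_mem_normPSD hp₁S) (ne_zero_of_mem_normPSD hp₁S)
    exact div_pos (hpd.re_dotProduct_pos (hvK _ hp₁K)) (hden _ (hvK _ hp₁K))
  -- Claim 1: on `S`, `T Z ≥ δ₁ X₀`
  have claim1 : ∀ Z ∈ S, (T Z - (δ₁ : ℂ) • X₀).PosSemidef := by
    intro Z hZS
    have hTZ : (T Z).PosSemidef := transferOp_pow_posSemidef A ℓ (posSemidef_of_mem_normPSD hZS)
    refine posSemidef_of_re_nonneg (hTZ.1.sub (isHermitian_real_smul hX₀.1 δ₁)) fun x => ?_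
    by_cases hx : x = 0
    · simp [hx]
    -- normalise `x`
    set c : ℝ := ‖x‖ with hc
    have hc0 : 0 < c := norm_pos_iff.mpr hx
    set u : Fin D → ℂ := (c⁻¹ : ℂ) • x with hu
    have huK : u ∈ K := by simp [K, u, norm_smul, hc0.ne', c]
    have hxu : x = (c : ℂ) • u := by
      rw [hu, smul_smul, mul_inv_cancel₀ (by exact_mod_cast hc0.ne'), one_smul]
    have hFu : δ₁ ≤ F (Z, u) := hmin (Set.mk_mem_prod hZS huK)
    have hden_u := hden u (hvK u huK)
    have hratio : δ₁ * (star u ⬝ᵥ X₀ *ᵥ u).re ≤ (star u ⬝ᵥ (T Z) *ᵥ u).re := by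
      rw [hF] at hFu
      exact (le_div_iff₀ hden_u).mp hFu
    clear_value u
    rw [sub_mulVec, dotProduct_sub, smul_mulVec, dotProduct_smul, smul_eq_mul, Complex.sub_re,
      Complex.re_ofReal_mul, hxu, star_smul_dotProduct_mulVec_smul (T Z) (c : ℂ) u,
      star_smul_dotProduct_mulVec_smul X₀ (c : ℂ) u, Complex.conj_ofReal, ← Complex.ofReal_mul,
      Complex.re_ofReal_mul, Complex.re_ofReal_mul]
    nlinarith [mul_pos hc0 hc0]
  -- Claim 2: rescale by the trace, uniformly on `S`
  have hcont_tr : Continuous fun Z : Matrix (Fin D) (Fin D) ℂ => (Z.trace).re :=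
    Complex.continuous_re.comp continuous_id.matrix_trace
  obtain ⟨ZM, hZMS, hZM⟩ := hScpt.exists_isMaxOn hSne hcont_tr.continuousOn
  set M := (ZM.trace).re with hM
  have hMpos : 0 < M :=
    trace_re_pos_of_posSemidef (posSemidef_of_mem_normPSD hZMS) (ne_zero_of_mem_normPSD hZMS)
  refine ⟨δ₁ / M, div_pos hδ₁pos hMpos, fun Z hZ => ?_⟩
  by_cases hZ0 : Z = 0
  · subst hZ0
    simp [PosSemidef.zero]
  obtain ⟨c, hc, Z', hZ'S, rfl⟩ := exists_smul_mem_normPSD hZ hZ0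
  have htr : (((c : ℂ) • Z').trace).re = c * (Z'.trace).re := by
    rw [trace_smul, smul_eq_mul, Complex.re_ofReal_mul]
  have htr_le : (Z'.trace).re ≤ M := hZM hZ'S
  have h1 : (T ((c : ℂ) • Z') - ((c * δ₁ : ℝ) : ℂ) • X₀).PosSemidef := by
    have := (claim1 Z' hZ'S).smul (Complex.zero_le_real.mpr hc.le)
    rwa [smul_sub, smul_smul, ← Complex.ofReal_mul, ← map_smul] at this
  have hcoef : 0 ≤ c * δ₁ - δ₁ / M * (c * (Z'.trace).re) := by
    have : δ₁ / M * (c * (Z'.trace).re) = c * δ₁ * ((Z'.trace).re / M) := by ring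
    rw [this]
    have hle : (Z'.trace).re / M ≤ 1 := (div_le_one hMpos).mpr htr_le
    nlinarith [mul_pos hc hδ₁pos]
  have h2 : (((c * δ₁ - δ₁ / M * (c * (Z'.trace).re) : ℝ) : ℂ) • X₀).PosSemidef :=
    hX₀.posSemidef.smul (Complex.zero_le_real.mpr hcoef)
  convert h1.add h2 using 1
  rw [htr]
  push_cast
  module

/-! ### One Doeblin step and its iteration -/

section Contraction

variable {V : Type*}

/-- Iterates of a fixed point. [folklore] -/
theorem pow_apply_of_apply_eq {R M : Type*} [Semiring R] [AddCommMonoid M] [Module R M]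
    (T : M →ₗ[R] M) {X₀ : M} (hT : T X₀ = X₀) (j : ℕ) : (T ^ j) X₀ = X₀ := by
  induction j with
  | zero => simp
  | succ j ih => rw [pow_succ, Module.End.mul_apply, hT, ih]

variable {n : Type*} [Fintype n] [DecidableEq n]

omit [Fintype n] [DecidableEq n] in
/-- Iterates of a positive map are positive. [folklore] -/
theorem pow_posSemidef_of_posSemidef (T : Matrix n n ℂ →ₗ[ℂ] Matrix n n ℂ)
    (hpos : ∀ Z : Matrix n n ℂ, Z.PosSemidef → (T Z).PosSemidef) (j : ℕ) {Z : Matrix n n ℂ}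
    (hZ : Z.PosSemidef) : ((T ^ j) Z).PosSemidef := by
  induction j with
  | zero => simpa
  | succ j ih => rw [pow_succ', Module.End.mul_apply]; exact hpos _ ih

omit [Fintype n] [DecidableEq n] in
/-- **Enclosures propagate under a positive map fixing `X₀`**: `a X₀ ≤ H ≤ b X₀` implies
`a X₀ ≤ T^j H ≤ b X₀`. [folklore] -/
theorem enclosure_pow_of_posSemidef (T : Matrix n n ℂ →ₗ[ℂ] Matrix n n ℂ)
    (hpos : ∀ Z : Matrix n n ℂ, Z.PosSemidef → (T Z).PosSemidef) {X₀ : Matrix n n ℂ}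
    (hTX₀ : T X₀ = X₀) {H : Matrix n n ℂ} {a b : ℝ} (ha : (H - (a : ℂ) • X₀).PosSemidef)
    (hb : ((b : ℂ) • X₀ - H).PosSemidef) (j : ℕ) :
    ((T ^ j) H - (a : ℂ) • X₀).PosSemidef ∧ ((b : ℂ) • X₀ - (T ^ j) H).PosSemidef := by
  have hfix := pow_apply_of_apply_eq T hTX₀ j
  constructor
  · have := pow_posSemidef_of_posSemidef T hpos j ha
    rwa [map_sub, map_smul, hfix] at this
  · have := pow_posSemidef_of_posSemidef T hpos j hb
    rwa [map_sub, map_smul, hfix] at this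

omit [DecidableEq n] in
/-- **One Doeblin step.** If `Φ ≥ 0`-preserving data satisfy the minorisation
`Φ Z ≥ δ (Re Tr Z) X₀` (`Z ≥ 0`) and `Φ X₀ = X₀`, then an enclosure `a X₀ ≤ Y ≤ b X₀` improves to
`a' X₀ ≤ Φ Y ≤ b' X₀` with `a' = a + δ (Re Tr Y - a Re Tr X₀)`,
`b' = b - δ (b Re Tr X₀ - Re Tr Y)`, so that `b' - a' = (1 - δ Re Tr X₀) (b - a)`. This is the
oscillation (Markov–Dobrushin) contraction step, here in the Loewner order relative to `X₀`.
[folklore] -/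
theorem doeblin_step (Φ : Matrix n n ℂ →ₗ[ℂ] Matrix n n ℂ) {X₀ : Matrix n n ℂ} {δ : ℝ}
    (hmin : ∀ Z : Matrix n n ℂ, Z.PosSemidef → (Φ Z - ((δ * Z.trace.re : ℝ) : ℂ) • X₀).PosSemidef)
    (hΦX₀ : Φ X₀ = X₀) {Y : Matrix n n ℂ} {a b : ℝ}
    (ha : (Y - (a : ℂ) • X₀).PosSemidef) (hb : ((b : ℂ) • X₀ - Y).PosSemidef) :
    (Φ Y - ((a + δ * (Y.trace.re - a * X₀.trace.re) : ℝ) : ℂ) • X₀).PosSemidef ∧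
      (((b - δ * (b * X₀.trace.re - Y.trace.re) : ℝ) : ℂ) • X₀ - Φ Y).PosSemidef := by
  have htra : ((Y - (a : ℂ) • X₀).trace).re = Y.trace.re - a * X₀.trace.re := by
    rw [trace_sub, trace_smul, smul_eq_mul, Complex.sub_re, Complex.re_ofReal_mul]
  have htrb : (((b : ℂ) • X₀ - Y).trace).re = b * X₀.trace.re - Y.trace.re := by
    rw [trace_sub, trace_smul, smul_eq_mul, Complex.sub_re, Complex.re_ofReal_mul]
  constructor
  · have h1 := hmin _ ha
    rw [htra, map_sub, map_smul, hΦX₀] at h1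
    convert h1 using 1
    push_cast
    module
  · have h1 := hmin _ hb
    rw [htrb, map_sub, map_smul, hΦX₀] at h1
    convert h1 using 1
    push_cast
    module

omit [DecidableEq n] in
/-- **Iterated Doeblin steps**: after `k` applications of `Φ` the enclosure width has shrunk by
the factor `(1 - δ Re Tr X₀)^k`. [folklore] -/
theorem doeblin_iterate (Φ : Matrix n n ℂ →ₗ[ℂ] Matrix n n ℂ) {X₀ : Matrix n n ℂ} {δ : ℝ}
    (hmin : ∀ Z : Matrix n n ℂ, Z.PosSemidef → (Φ Z - ((δ * Z.trace.re : ℝ) : ℂ) • X₀).PosSemidef)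
    (hΦX₀ : Φ X₀ = X₀) (k : ℕ) :
    ∀ {Y : Matrix n n ℂ} {a b : ℝ}, (Y - (a : ℂ) • X₀).PosSemidef →
      ((b : ℂ) • X₀ - Y).PosSemidef →
      ∃ a' b' : ℝ, ((Φ ^ k) Y - (a' : ℂ) • X₀).PosSemidef ∧
        ((b' : ℂ) • X₀ - (Φ ^ k) Y).PosSemidef ∧
        b' - a' = (1 - δ * X₀.trace.re) ^ k * (b - a) := by
  induction k with
  | zero =>
    intro Y a b ha hb
    exact ⟨a, b, by simpa using ha, by simpa using hb, by simp⟩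
  | succ k ih =>
    intro Y a b ha hb
    obtain ⟨a', b', ha', hb', hw⟩ := ih ha hb
    have hstep := doeblin_step Φ hmin hΦX₀ ha' hb'
    refine ⟨a' + δ * (((Φ ^ k) Y).trace.re - a' * X₀.trace.re),
      b' - δ * (b' * X₀.trace.re - ((Φ ^ k) Y).trace.re), ?_, ?_, ?_⟩
    · rw [pow_succ', Module.End.mul_apply]
      exact hstep.1
    · rw [pow_succ', Module.End.mul_apply]
      exact hstep.2
    · rw [pow_succ', mul_assoc, ← hw]
      ring

end Contraction

/-! ### Geometric to exponential rate -/

/-- `θ^(n / ℓ) ≤ 2 e^{-n/ξ}` with `ξ = -ℓ / log (max θ ½)` for `0 ≤ θ < 1`, `0 < ℓ`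
(integer division). [folklore] -/
theorem pow_div_le_two_mul_exp {θ : ℝ} (hθ0 : 0 ≤ θ) (hθ1 : θ < 1) {ℓ : ℕ} (hℓ : 0 < ℓ) (n : ℕ) :
    θ ^ (n / ℓ) ≤ 2 * Real.exp (-((n : ℝ) / (-(ℓ : ℝ) / Real.log (max θ 2⁻¹)))) := by
  set θ₁ := max θ 2⁻¹ with hθ₁
  have hθ₁pos : 0 < θ₁ := lt_max_of_lt_right (by norm_num)
  have hθ₁lt : θ₁ < 1 := max_lt hθ1 (by norm_num)
  have hlog : Real.log θ₁ < 0 := Real.log_neg hθ₁pos hθ₁lt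
  have h1 : θ ^ (n / ℓ) ≤ θ₁ ^ (n / ℓ) := pow_le_pow_left₀ hθ0 (le_max_left _ _) _
  have hk : (n : ℝ) / ℓ - 1 ≤ ((n / ℓ : ℕ) : ℝ) := by
    have hdm := Nat.div_add_mod n ℓ
    have hmod : ((n % ℓ : ℕ) : ℝ) < ℓ := by exact_mod_cast Nat.mod_lt n hℓ
    have hℓpos : (0 : ℝ) < ℓ := by exact_mod_cast hℓ
    have hn : (n : ℝ) = ℓ * ((n / ℓ : ℕ) : ℝ) + ((n % ℓ : ℕ) : ℝ) := by exact_mod_cast hdm.symm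
    rw [sub_le_iff_le_add, div_le_iff₀ hℓpos]
    nlinarith
  have h2 : θ₁ ^ (n / ℓ) = Real.exp (((n / ℓ : ℕ) : ℝ) * Real.log θ₁) := by
    rw [← Real.log_pow, Real.exp_log (pow_pos hθ₁pos _)]
  have h3 : ((n / ℓ : ℕ) : ℝ) * Real.log θ₁ ≤ ((n : ℝ) / ℓ - 1) * Real.log θ₁ :=
    mul_le_mul_of_nonpos_right hk hlog.le
  have h4 : ((n : ℝ) / ℓ - 1) * Real.log θ₁ =
      -((n : ℝ) / (-(ℓ : ℝ) / Real.log θ₁)) + -Real.log θ₁ := by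
    have hℓne : (ℓ : ℝ) ≠ 0 := by exact_mod_cast hℓ.ne'
    field_simp
    ring
  calc θ ^ (n / ℓ) ≤ θ₁ ^ (n / ℓ) := h1
    _ = Real.exp (((n / ℓ : ℕ) : ℝ) * Real.log θ₁) := h2
    _ ≤ Real.exp (-((n : ℝ) / (-(ℓ : ℝ) / Real.log θ₁)) + -Real.log θ₁) :=
        Real.exp_le_exp.mpr (h3.trans_eq h4)
    _ = Real.exp (-((n : ℝ) / (-(ℓ : ℝ) / Real.log θ₁))) * θ₁⁻¹ := by
        rw [Real.exp_add, Real.exp_neg (Real.log θ₁), Real.exp_log hθ₁pos]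
    _ ≤ Real.exp (-((n : ℝ) / (-(ℓ : ℝ) / Real.log θ₁))) * 2 := by
        gcongr
        rw [inv_le_comm₀ hθ₁pos (by norm_num)]
        exact le_max_right _ _
    _ = _ := by ring


end QLattice

end Literature.MathematicalPhysics.QuantumLattice
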